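import Literature.Probability.RandomPlanarGeometry.SLEBoundaryHitting
import Literature.Probability.RandomPlanarGeometry.SLEOnePointMartingaleProofs
import Literature.Probability.RandomPlanarGeometry.SLEOnePointSwallowingProofs
import Literature.Probability.RandomPlanarGeometry.SLETwoPointItoProofs
import HarnessLib

/-!
# Swallowing of real points by chordal SLE_κ: the discharges of `SLEBoundaryHitting`

This file discharges the two remaining named facts of
`Literature.Probability.RandomPlanarGeometry.SLEBoundaryHitting` (the third,
`sle_swallowingTime_ofReal_eq_firstHit`, is proved in `SLEBoundaryHittingProofs`). It is a separate
leaf because the proofs live downstream of `SLEBoundaryHittingProofs`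
(`SLEBoundaryHittingProofs` ← `SLECrossingProbabilityProofs` ← `SLEOnePointSwallowingProofs`), so
they cannot be appended to either sibling without an import cycle.

* `Literature.Probability.RandomPlanarGeometry.sle_swallowingTime_ofReal_lt_top_holds` — **Lawler
  (2005), Prop. 6.8, second item** (print p. 150): "If `κ > 4`, then w.p.1 `T_x < ∞` for all
  `x > 0`"; in print "a restatement of Proposition 1.21 with `a = 2/κ`" (the Bessel-type flow
  `dX = (a/X) dt + dB`, `a < 1/2`). In the tree: the two Itô steps of Prop. 1.21 are the proved
  one-point martingales `sle_martingale_onePointPow_holds` (`(X_{t∧σ})^{1-4/κ}`) and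
  `sle_martingale_onePointSq_holds` (`X²_{t∧σ} - (4+κ)(t∧σ)`) of `SLEOnePointMartingaleProofs`;
  optional stopping, `R → ∞`, countably many points and the monotonicity of `x ↦ T_x` are
  `sle_swallowingTime_ofReal_lt_top_of_onePointMartingales` (`SLEOnePointSwallowingProofs`).
* `Literature.Probability.RandomPlanarGeometry.sle_measureReal_swallowingTime_lt_holds` — **Lawler
  (2005), §6.7, Prop. 6.33** with the sentence preceding it (print pp. 163–164): for `κ > 4` and
  `x, y > 0`, `P{T_x < T_{-y}} = P{T_{-x} < T_y} = Ψ_{2/κ}(y/(x+y))`. In the tree: the Itô step is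
  the proved two-point martingale `sle_martingale_twoPointObservable_holds` (`SLETwoPointItoProofs`),
  the optional-stopping assembly is `sle_measureReal_swallowingTime_lt_of_martingale_of_ae`
  (`SLECrossingProbabilityProofs`), and its a.s.-finiteness input is
  `sle_swallowingTime_lt_top_of_onePointMartingales` fed with the two one-point martingales.

Nothing new is defined here; no statement is changed.

## References

* G. F. Lawler, *Conformally Invariant Processes in the Plane*, AMS Math. Surveys 114 (2005):
  §1.10 Prop. 1.21 (print p. 26), §6.2 Prop. 6.8 (print p. 150), §6.7 Prop. 6.33 (pp. 163–164).
* S. Rohde, O. Schramm, *Basic properties of SLE*, Ann. of Math. 161 (2005), Lemma 6.5.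
-/

namespace Literature.Probability.RandomPlanarGeometry

/-- **Every positive real point is swallowed by SLE_κ, `κ > 4`**
(`Literature.Probability.RandomPlanarGeometry.sle_swallowingTime_ofReal_lt_top` holds; Lawler (2005),
Prop. 6.8, second item, p. 150: "If `κ > 4`, then w.p.1 `T_x < ∞` for all `x > 0`", proved in print as
"a restatement of Proposition 1.21 with `a = 2/κ`"). For `preWienerMeasure`-a.e. `ω`, every `x > 0`
has finite swallowing time under the Loewner flow driven by `√κ B(ω)`. Assembled from the proved
one-point martingales (`sle_martingale_onePointPow_holds`, `sle_martingale_onePointSq_holds`; the Itô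
steps of Prop. 1.21) by `sle_swallowingTime_ofReal_lt_top_of_onePointMartingales` (optional stopping,
`P{T_x = ∞} ≤ (x/R)^{1-4/κ} → 0`, countably many points, monotonicity of `x ↦ T_x`).
[cite: Lawler2005, Prop. 6.8] -/
theorem sle_swallowingTime_ofReal_lt_top_holds : sle_swallowingTime_ofReal_lt_top :=
  sle_swallowingTime_ofReal_lt_top_of_onePointMartingales sle_martingale_onePointPow_holds
    sle_martingale_onePointSq_holds

/-- **Crossing (swallowing) probabilities for chordal SLE_κ, `κ > 4`**
(`Literature.Probability.RandomPlanarGeometry.sle_measureReal_swallowingTime_lt` holds; Lawler (2005),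
§6.7, Prop. 6.33 with the sentence preceding it, pp. 163–164): for `x, y > 0`,
`P{T_x < T_{-y}} = P{T_{-x} < T_y} = Γ(2-4a)/(Γ(2-2a)Γ(1-2a)) r^{1-2a} ₂F₁(2a, 1-2a; 2-2a; r)` with
`a = 2/κ`, `r = y/(x+y)` (`swallowingProb (2/κ) (y/(x+y))`). Assembled by
`sle_measureReal_swallowingTime_lt_of_martingale_of_ae` (optional stopping for the two-point
observable, `SLECrossingProbabilityProofs`) from the proved two-point martingale
`sle_martingale_twoPointObservable_holds` (the Itô step of Prop. 6.33, `SLETwoPointItoProofs`) and the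
per-point a.s. finiteness of `T_x` for `κ > 4` (`sle_swallowingTime_lt_top_of_onePointMartingales`
with `sle_martingale_onePointPow_holds`, `sle_martingale_onePointSq_holds`).
[cite: Lawler2005, Prop. 6.33] -/
theorem sle_measureReal_swallowingTime_lt_holds : sle_measureReal_swallowingTime_lt :=
  sle_measureReal_swallowingTime_lt_of_martingale_of_ae sle_martingale_twoPointObservable_holds
    (sle_swallowingTime_lt_top_of_onePointMartingales sle_martingale_onePointPow_holds
      sle_martingale_onePointSq_holds)

end Literature.Probability.RandomPlanarGeometry
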